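import Summits.SmoothPoincare4.SmoothPoincare4.Theorems.ConvexBisectionAcyclicBisectionExistsHurwitzMoveClasses
import Summits.SmoothPoincare4.SmoothPoincare4.Theorems.ConvexBisectionAcyclicBisectionExistsBeltMonodromyPages
import Summits.SmoothPoincare4.SmoothPoincare4.Theorems.ConvexBisectionAcyclicBisectionExistsPicardLefschetzChart
import Summits.SmoothPoincare4.SmoothPoincare4.Theorems.ConvexBisectionAcyclicBisectionExistsHurwitzMoveCrossTwist
import HarnessLib

/-!
# N1-move, bridge (e×) `piece_e_cross`, tool 4: reading boundary points on the base, page rotations,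
# and the relative openness of the chart region (wave 8, worker J4, brick of stub `stub_M2geo` =
# node N1 ▸ contract `node_N1_move_of_pieces` ▸ `HD` = `piece_e_cross piece_d`, line `modp-braid-orbits`,
# crux `ConvexBisection.AcyclicBisectionExists`, item stmt-SmoothPoincare4-10508; registered sub-goal
# `helper_mem_page_of_flat_ray`)

Preparations for the SLAB RETRACTION of the bridge (e×) (`…HurwitzMoveCrossSlab.lean`): the map `Π`
from the swept slab of `∂X₀` to the base which reads every point "at the top level, in H4's chart
coordinates" is glued from four pieces; this file supplies the ingredients that do not mention the
belt chart:

* §1 flows of the base: `flow_neg_apply`/`flow_apply_neg` (the stages of a flow are inverted by negating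
  time), `mem_page_of_flow_mem_page` (a page rotation carries only page points to page points);
  **`mem_page_of_flat_ray`** — a boundary point of the base with `‖x‖² < 4` on the `w`-ray of a unit
  direction `u` lies on `page g u`;
* §2 the SEAM READING `y ↦ jA⁻¹ (G₀ (bX.incl y))` of boundary points: the seam set is open and the
  reading is continuous on it (`isOpen_seam`, `continuousOn_seamRead`, `seamRead_eq`);
* §3 `eventually_mem_image_strip` — for a map continuous on a set with values on pages wherever
  `‖x‖² < 4`, being read inside the open annulus of an N1a chart is an open condition
  (`chart_relOpen`); `continuousOn_read_chart_on` — reading a periodic function through the chart is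
  continuous (the `ContinuousOn` form of `CrossTwist.continuousOn_read_chart`);
* §4 `mem_page_two_mul_w`, **`reading_level_zero_mem_page`** — the level-`0` reading
  `R_{−εl/κ} (jA⁻¹ (G₀ (bX.incl y)))` of a seam point of direction `e e^{iεl}` lies on `page g e` wherever
  flat (stages of an ambient isotopy preserve the boundary; a flat boundary point lies on the page of its own
  direction `2w`; a page rotation carries only page points to page points).

Everything is proved; no definitions, no named facts, no `sorry`.  Reference: R. E. Gompf,
A. I. Stipsicz, *4-Manifolds and Kirby Calculus* (1999), §8.2 [GompfStipsicz1999]. [folklore]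
-/

noncomputable section

set_option linter.dupNamespace false

open scoped Manifold ContDiff Topology Real
open Set Function Filter

namespace Summit.SmoothPoincare4.SmoothPoincare4.Theorems.AcyclicBisectionExists.ModpBraidOrbits

open Literature.Topology.FourManifolds Literature.Topology.FourManifolds.LefschetzBase
open Literature.Topology.FourManifolds.HandleAttachingMap
open HurwitzMoveClasses CrossTwist

namespace CrossSlab

variable {g : ℕ}

/-! ## §1 Flows of the base and pages -/

/-- A stage of a flow is undone by the stage at the opposite time. [folklore] -/
theorem flow_neg_apply (R : AmbientIsotopy (𝓡∂ 4) (Base g))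
    (hRflow : ∀ (t s : ℝ) (p : Base g), R.toFun t (R.toFun s p) = R.toFun (t + s) p) (t : ℝ)
    (p : Base g) : R.toFun (-t) (R.toFun t p) = p := by
  rw [hRflow, neg_add_cancel, R.map_zero, id]

/-- A stage of a flow undoes the stage at the opposite time. [folklore] -/
theorem flow_apply_neg (R : AmbientIsotopy (𝓡∂ 4) (Base g))
    (hRflow : ∀ (t s : ℝ) (p : Base g), R.toFun t (R.toFun s p) = R.toFun (t + s) p) (t : ℝ)
    (p : Base g) : R.toFun t (R.toFun (-t) p) = p := by
  rw [hRflow, add_neg_cancel, R.map_zero, id]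

/-- **A page rotation carries only page points to page points**: if `R_t p` lies on the page of
direction `c'` then `p` lies on the page of direction `c' e^{−iκt}`. [folklore] -/
theorem mem_page_of_flow_mem_page (R : AmbientIsotopy (𝓡∂ 4) (Base g)) {κ : ℝ}
    (hRflow : ∀ (t s : ℝ) (p : Base g), R.toFun t (R.toFun s p) = R.toFun (t + s) p)
    (hRpage : ∀ (t : ℝ) (c' : ℂ) (p : Base g), p ∈ page g c' →
      R.toFun t p ∈ page g (c' * Complex.exp (((κ * t : ℝ) : ℂ) * Complex.I)))
    {t : ℝ} {c' : ℂ} {p : Base g} (hp : R.toFun t p ∈ page g c') :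
    p ∈ page g (c' * Complex.exp (((κ * -t : ℝ) : ℂ) * Complex.I)) := by
  have h := hRpage (-t) c' _ hp
  rwa [flow_neg_apply R hRflow] at h

/-- **A flat boundary point on a ray lies on the page**: a point of `∂ Base g` with `‖x‖² < 4` whose
`w` is a positive multiple of the unit direction `u` lies on `page g u`. [folklore] -/
theorem mem_page_of_flat_ray {a : Base g} (ha : a ∈ (𝓡∂ 4).boundary (Base g))
    (hflat : ‖cx a.1‖ ^ 2 < 4) {u : ℂ} (hu : ‖u‖ = 1) {c : ℝ} (hc : 0 < c)
    (hw : w g a.1 = (c : ℂ) * u) : a ∈ page g u := by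
  refine ⟨hflat, ?_⟩
  have hρ : rho g a.1 = 1 / 4 := (RegularSublevel.mem_boundary_iff (isRegularLevel_rho g) a).1 ha
  rw [rho, eta_of_le hflat.le, add_zero, hw, norm_mul, Complex.norm_real, Real.norm_eq_abs,
    abs_of_pos hc, hu, mul_one] at hρ
  have hc2 : c = 1 / 2 := by nlinarith
  rw [hw, hc2]
  push_cast
  ring

/-! ## §2 The seam reading -/

section Seam

variable {n : ℕ} {h : Fin n → HandleAttachingMap 3 2 (Base g)}
  {X₀ : Type} [TopologicalSpace X₀] [ChartedSpace (EuclideanHalfSpace 4) X₀]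
  {X : Type} [TopologicalSpace X] [ChartedSpace (EuclideanHalfSpace 4) X]
  (bX : BoundaryData (𝓡∂ 4) X₀ (𝓡 3)) (G₀ : X₀ ≃ₘ⟮𝓡∂ 4, 𝓡∂ 4⟯ X)
  (D : MultiAttachmentData h (𝓡∂ 4) X)

/-- **The seam set is open** in `∂X₀`. [folklore] -/
theorem isOpen_seam : IsOpen {y : bX.carrier | G₀ (bX.incl y) ∈ range D.jA} :=
  D.hjAo.preimage (G₀.continuous.comp bX.continuous_incl)

/-- **The seam reading is continuous on the seam set.** [folklore] -/
theorem continuousOn_seamRead [Nonempty ↥(coresComplement h)] :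
    ContinuousOn (fun y : bX.carrier => ((Function.invFun D.jA (G₀ (bX.incl y)) :
      ↥(coresComplement h)) : Base g)) {y : bX.carrier | G₀ (bX.incl y) ∈ range D.jA} := by
  refine continuous_subtype_val.comp_continuousOn ?_
  exact (continuousOn_invFun_range D.hjA.isEmbedding).comp
    (G₀.continuous.comp bX.continuous_incl).continuousOn fun y hy => hy

/-- The seam reading of a seam point presented by `a` is `a`. [folklore] -/
theorem seamRead_eq [Nonempty ↥(coresComplement h)] {y : bX.carrier} {a : ↥(coresComplement h)}
    (hy : G₀ (bX.incl y) = D.jA a) : Function.invFun D.jA (G₀ (bX.incl y)) = a := by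
  rw [hy, invFun_apply D.injective_jA]

end Seam

/-! ## §3 Reading through an annulus chart on a set -/

variable {c : ℂ} {φ : ℝ × ℝ → Base g}

/-- **Being read inside the open annulus is an open condition.**  Let `φ` be an N1a annulus chart
of `page g c` and `γ` continuous on `S` with values on the page wherever `‖x‖² < 4`.  If `γ y₀` lies
in the open annulus `φ(ℝ × (−1, 1))`, so does `γ y` for `y ∈ S` near `y₀`. [folklore] -/
theorem eventually_mem_image_strip {Y : Type*} [TopologicalSpace Y] (hc : ‖c‖ = 1)
    (hφc : Continuous φ) (hφ1 : ∀ u r, φ (u + 1, r) = φ (u, r)) (hφp : ∀ p, φ p ∈ page g c)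
    (hφi : InjOn φ (Ico (0 : ℝ) 1 ×ˢ Ioo (-1 : ℝ) 1)) {S : Set Y} {γ : Y → Base g}
    (hγ : ContinuousOn γ S) (hγp : ∀ y ∈ S, ‖cx (γ y).1‖ ^ 2 < 4 → γ y ∈ page g c) {y₀ : Y}
    (hy₀ : y₀ ∈ S) (h₀ : γ y₀ ∈ φ '' (univ ×ˢ Ioo (-1 : ℝ) 1)) :
    ∀ᶠ y in 𝓝[S] y₀, γ y ∈ φ '' (univ ×ˢ Ioo (-1 : ℝ) 1) := by
  obtain ⟨p₀, ⟨-, hp₀⟩, hp₀y⟩ := h₀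
  obtain ⟨O, hO, hOsub⟩ := chart_relOpen hc hφc hφ1 hφp hφi hp₀
    ((isOpen_univ.prod isOpen_Ioo).mem_nhds (⟨trivial, hp₀⟩ : p₀ ∈ univ ×ˢ Ioo (-1 : ℝ) 1))
  have hflat : ∀ᶠ q in 𝓝 (φ p₀), ‖cx q.1‖ ^ 2 < 4 := CrossTwist.eventually_normSq_cx_lt (hφp p₀)
  rw [hp₀y] at hO hflat
  filter_upwards [(hγ y₀ hy₀).eventually (Filter.inter_mem hO hflat), self_mem_nhdsWithin]
    with y hy hyS
  exact hOsub _ hy.1 (hγp y hyS hy.2)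

/-- **Reading a periodic function through the chart is continuous** (`ContinuousOn` form): with `φ`
an N1a chart, `γ` continuous on `S` (page-valued wherever `‖x‖² < 4`), `F : Y → ℝ × ℝ → Z` jointly
continuous and `1`-periodic in the abscissa, and `P y` a preimage of `γ y` in the strip for `y ∈ T ⊆ S`,
the map `y ↦ F y (P y)` is continuous on `T`. [folklore] -/
theorem continuousOn_read_chart_on {Y Z : Type*} [TopologicalSpace Y] [TopologicalSpace Z]
    (hc : ‖c‖ = 1) (hφc : Continuous φ) (hφ1 : ∀ u r, φ (u + 1, r) = φ (u, r))
    (hφp : ∀ p, φ p ∈ page g c) (hφi : InjOn φ (Ico (0 : ℝ) 1 ×ˢ Ioo (-1 : ℝ) 1))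
    {S T : Set Y} (hTS : T ⊆ S) {γ : Y → Base g} (hγ : ContinuousOn γ S)
    (hγp : ∀ y ∈ S, ‖cx (γ y).1‖ ^ 2 < 4 → γ y ∈ page g c)
    {F : Y → ℝ × ℝ → Z} (hF : Continuous (uncurry F)) (hF1 : ∀ y u r, F y (u + 1, r) = F y (u, r))
    {P : Y → ℝ × ℝ} (hP : ∀ y ∈ T, (P y).2 ∈ Ioo (-1 : ℝ) 1) (hPγ : ∀ y ∈ T, φ (P y) = γ y) :
    ContinuousOn (fun y => F y (P y)) T := by
  have hFint : ∀ y (m : ℤ) (u r : ℝ), F y (u + m, r) = F y (u, r) := fun y m u r => by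
    induction m using Int.induction_on generalizing u with
    | zero => simp
    | succ k ih =>
      have e := hF1 y (u + k) r
      rw [add_assoc] at e
      have e' := ih u
      push_cast at e' ⊢
      rw [e, e']
    | pred k ih =>
      have e := hF1 y (u + (-(k : ℝ) - 1)) r
      rw [add_assoc, show -(k : ℝ) - 1 + 1 = -(k : ℝ) by ring] at e
      have e' := ih u
      push_cast at e' ⊢
      rw [← e, e']
  intro y₀ hy₀
  rw [ContinuousWithinAt, tendsto_nhds]
  intro U hU hU0
  have hFat : ContinuousAt (uncurry F) (y₀, P y₀) := hF.continuousAt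
  have hpre : (uncurry F) ⁻¹' U ∈ 𝓝 (y₀, P y₀) := hFat.preimage_mem_nhds (hU.mem_nhds hU0)
  rw [nhds_prod_eq, mem_prod_iff] at hpre
  obtain ⟨V, hV, N, hN, hVN⟩ := hpre
  have hN' : N ∩ univ ×ˢ Ioo (-1 : ℝ) 1 ∈ 𝓝 (P y₀) :=
    inter_mem hN ((isOpen_univ.prod isOpen_Ioo).mem_nhds ⟨trivial, hP y₀ hy₀⟩)
  obtain ⟨O, hO, hOsub⟩ := chart_relOpen hc hφc hφ1 hφp hφi (hP y₀ hy₀) hN'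
  have hflat : ∀ᶠ q in 𝓝 (φ (P y₀)), ‖cx q.1‖ ^ 2 < 4 := CrossTwist.eventually_normSq_cx_lt (hφp (P y₀))
  rw [hPγ y₀ hy₀] at hO hflat
  have h1 : ∀ᶠ y in 𝓝[S] y₀, γ y ∈ O ∧ ‖cx (γ y).1‖ ^ 2 < 4 :=
    (hγ y₀ (hTS hy₀)).eventually (Filter.inter_mem hO hflat)
  have h1' : ∀ᶠ y in 𝓝[T] y₀, γ y ∈ O ∧ ‖cx (γ y).1‖ ^ 2 < 4 := h1.filter_mono (nhdsWithin_mono _ hTS)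
  filter_upwards [h1', mem_nhdsWithin_of_mem_nhds hV, self_mem_nhdsWithin] with y hy hyV hyT
  obtain ⟨p, ⟨hpN, -, hp2⟩, hpy⟩ := hOsub (γ y) hy.1 (hγp y (hTS hyT) hy.2)
  show F y (P y) ∈ U
  obtain ⟨h2, m, hm⟩ := chart_eq_iff hφ1 hφi hp2 (hP y hyT) (hpy.trans (hPγ y hyT).symm)
  have e : P y = (p.1 + m, p.2) := by rw [← hm, h2]
  rw [e, hFint]
  exact hVN (mk_mem_prod hyV hpN)

/-! ## §4 The level-`0` reading of a seam point lies on the belt page wherever flat -/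

section SeamLevel

variable {n : ℕ} {h : Fin n → HandleAttachingMap 3 2 (Base g)}
  {X₀ : Type} [TopologicalSpace X₀] [ChartedSpace (EuclideanHalfSpace 4) X₀]
  {X : Type} [TopologicalSpace X] [ChartedSpace (EuclideanHalfSpace 4) X]

/-- **A flat boundary point lies on the page of its own direction `2w`.** [folklore] -/
theorem mem_page_two_mul_w {a : Base g} (ha : a ∈ (𝓡∂ 4).boundary (Base g)) (hflat : ‖cx a.1‖ ^ 2 < 4) :
    ‖2 * w g a.1‖ = 1 ∧ a ∈ page g (2 * w g a.1) := by
  have hρ : rho g a.1 = 1 / 4 := (RegularSublevel.mem_boundary_iff (isRegularLevel_rho g) a).1 ha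
  rw [rho, eta_of_le hflat.le, add_zero] at hρ
  have hn : ‖w g a.1‖ = 1 / 2 := by
    have h0 : 0 ≤ ‖w g a.1‖ := norm_nonneg _
    nlinarith
  have hu : ‖2 * w g a.1‖ = 1 := by rw [norm_mul, hn]; norm_num
  exact ⟨hu, mem_page_of_flat_ray ha hflat hu (c := 1 / 2) (by norm_num) (by push_cast; ring)⟩

/-- **The level-`0` reading of a seam point lies on the belt page wherever flat.**  If
`G₀ (bX.incl y) = D.jA a`, `Ψ y` has direction `e e^{iεl}` and `R_{−εl/κ} a` is flat, then
`R_{−εl/κ} a ∈ page g e` (`R` a page rotation: a flow with `R_t : page c' → page (c' e^{iκt})`).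
[cite: GompfStipsicz1999, §8.2] -/
theorem reading_level_zero_mem_page
    (bX : BoundaryData (𝓡∂ 4) X₀ (𝓡 3)) (Ψ : bX.carrier ≃ₘ⟮𝓡 3, 𝓡 3⟯ (bBase g).carrier)
    (G₀ : X₀ ≃ₘ⟮𝓡∂ 4, 𝓡∂ 4⟯ X) (D : MultiAttachmentData h (𝓡∂ 4) X) {e : ℂ} (he : ‖e‖ = 1)
    (hseam : ∀ (y : bX.carrier) (a : ↥(coresComplement h)), G₀ (bX.incl y) = D.jA a →
      ∃ c : ℝ, 0 < c ∧ w g ((bBase g).incl (Ψ y)).1 = (c : ℂ) * w g (a : Base g).1)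
    (R : AmbientIsotopy (𝓡∂ 4) (Base g)) {κ : ℝ} (hκ : κ ≠ 0) (ε : ℝ)
    (hRflow : ∀ (t s : ℝ) (p : Base g), R.toFun t (R.toFun s p) = R.toFun (t + s) p)
    (hRpage : ∀ (t : ℝ) (c' : ℂ) (p : Base g), p ∈ page g c' →
      R.toFun t p ∈ page g (c' * Complex.exp (((κ * t : ℝ) : ℂ) * Complex.I)))
    {y : bX.carrier} {a : ↥(coresComplement h)} (hya : G₀ (bX.incl y) = D.jA a) {l : ℝ}
    (hl : ∃ c : ℝ, 0 < c ∧
      w g ((bBase g).incl (Ψ y)).1 = (c : ℂ) * (e * Complex.exp (((ε * l : ℝ) : ℂ) * Complex.I)))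
    (hflat : ‖cx (R.toFun (-(ε * l / κ)) (a : Base g)).1‖ ^ 2 < 4) :
    R.toFun (-(ε * l / κ)) (a : Base g) ∈ page g e := by
  have habd : (a : Base g) ∈ (𝓡∂ 4).boundary (Base g) := mem_boundary_of_G₀_incl_eq_jA bX G₀ D hya
  -- the transported point is a flat boundary point, hence on the page of its direction; so `a` is flat
  have hbbd : R.toFun (-(ε * l / κ)) (a : Base g) ∈ (𝓡∂ 4).boundary (Base g) := by
    have h1 := (R.isLocalDiffeomorph (-(ε * l / κ))).preimage_boundary (by simp)
    have h2 : (a : Base g) ∈ R.toFun (-(ε * l / κ)) ⁻¹' (𝓡∂ 4).boundary (Base g) := by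
      rw [h1]; exact habd
    exact h2
  obtain ⟨-, hbp⟩ := mem_page_two_mul_w hbbd hflat
  have hap := mem_page_of_flow_mem_page R hRflow hRpage hbp
  have haflat : ‖cx (a : Base g).1‖ ^ 2 < 4 := hap.1
  -- the direction of `a` is that of `Ψ y`, i.e. `e e^{iεl}`
  obtain ⟨c₁, hc₁, hw₁⟩ := hseam y a hya
  obtain ⟨c₂, hc₂, hw₂⟩ := hl
  have hwa : w g (a : Base g).1 = ((c₂ / c₁ : ℝ) : ℂ) * (e * Complex.exp (((ε * l : ℝ) : ℂ) * Complex.I)) := by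
    have hc₁' : (c₁ : ℂ) ≠ 0 := by exact_mod_cast hc₁.ne'
    rw [hw₁] at hw₂
    push_cast at hw₂ ⊢
    field_simp
    linear_combination hw₂
  have hue : ‖e * Complex.exp (((ε * l : ℝ) : ℂ) * Complex.I)‖ = 1 := by
    rw [norm_mul, he, Complex.norm_exp_ofReal_mul_I, mul_one]
  have hapage : (a : Base g) ∈ page g (e * Complex.exp (((ε * l : ℝ) : ℂ) * Complex.I)) :=
    mem_page_of_flat_ray habd haflat hue (div_pos hc₂ hc₁) hwa
  have hexp : e * Complex.exp (((ε * l : ℝ) : ℂ) * Complex.I) *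
      Complex.exp (((κ * -(ε * l / κ) : ℝ) : ℂ) * Complex.I) = e := by
    rw [show κ * -(ε * l / κ) = -(ε * l) by field_simp, mul_assoc, ← Complex.exp_add]
    push_cast
    rw [show (ε : ℂ) * (l : ℂ) * Complex.I + -((ε : ℂ) * (l : ℂ)) * Complex.I = 0 by ring, Complex.exp_zero,
      mul_one]
  have := hRpage (-(ε * l / κ)) _ _ hapage
  rwa [hexp] at this

end SeamLevel

end CrossSlab

open CrossSlab

/-! ## The registered form -/

/-- **Sub-goal `helper_mem_page_of_flat_ray`** (J4, bridge (e×) of the N1 contract, tool 4, fully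
qualified): a boundary point of the base with `‖x‖² < 4` on the `w`-ray of a unit direction lies on
the page of that direction. [cite: GompfStipsicz1999, §8.2] -/
theorem helper_mem_page_of_flat_ray : ∀ (g : ℕ) (a : Literature.Topology.FourManifolds.LefschetzBase.Base g) (u : ℂ) (c : ℝ), a ∈ (𝓡∂ 4).boundary (Literature.Topology.FourManifolds.LefschetzBase.Base g) → ‖Literature.Topology.FourManifolds.LefschetzBase.cx a.1‖ ^ 2 < 4 → ‖u‖ = 1 → 0 < c → Literature.Topology.FourManifolds.LefschetzBase.w g a.1 = (c : ℂ) * u → a ∈ Literature.Topology.FourManifolds.LefschetzBase.page g u :=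
  fun _ _ _ _ ha hflat hu hc hw => mem_page_of_flat_ray ha hflat hu hc hw

end Summit.SmoothPoincare4.SmoothPoincare4.Theorems.AcyclicBisectionExists.ModpBraidOrbits

end
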